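import Mathlib
import HarnessLib

/-!
# Cartan's two-term lemma: what the moment identity (II) of the junction test allows at a trivalent face
# (concurrency, no tear) and at an X-crossing of two flat sheets (exactly one tear parameter)

Helper for crux K1 (`TropicalWeilVanishing`, stmt-HodgeConjecture-18478) of route `TropicalWeilObstruction` —
negation-sink work of cell `pub-hodge-tropical` (tropical-1 gen 37, HOME `certificates/schoenjunction/README.md`
§1); it decides nothing about K1 and nothing here bears on the Hodge conjecture.

Setting. In the first-order junction system (HOME `certificates/splitrigidity/README.md` §11, companion file
`…JunctionMoment.lean`) every top stratum `h` of the support incident to a codimension-one stratum `F` carries a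
velocity `u_h` (a vector of `P = V/L_F`), a positive weight `W_h` and a primitive outward direction `n_h ∈ P`, and
condition (II) says `Σ_h W_h (u_h ∧ n_h) = 0` in `⋀² P` — equivalently `Σ_h W_h B(u_h, n_h) = 0` for EVERY
alternating bilinear form `B` on `P`. Two incidence patterns matter for the tropical Schoen cycle:
* a TRIVALENT wall (`W₁n₁ + W₂n₂ + W₃n₃ = 0`): with `x = u₁ − u₃`, `y = u₂ − u₃`, `n = W₁n₁`, `m = W₂n₂`, (II) reads
  `B(x,n) + B(y,m) = 0` for all alternating `B`;
* an X-CROSSING of two flat sheets (halves `A, B` with directions `±n₀` and weight `W₁`; halves `C, D` with `±m₀`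
  and `W₂`): with `x = W₁(u_A − u_B)`, `y = W₂(u_C − u_D)`, `n = n₀`, `m = m₀`, (II) reads the same.
`cartan_two` below: if `n, m` are linearly independent, then `B(x,n) + B(y,m) = 0` for all alternating `B` iff
`x = a n + b m`, `y = b n + c m` with a SYMMETRIC coefficient (the same `b`). Read back: at a trivalent wall the
three strata stay CONCURRENT (`u_F := u₃ + b(n₁' + n₂')`-type common point; no tear), and at an X-crossing the two
sheets are torn by PROPORTIONAL transversal offsets `W₁(u_A − u_B) ≡ b·m₀ (mod n₀)`, `W₂(u_C − u_D) ≡ b·n₀ (mod m₀)`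
— one tear parameter `b`, the tropical resolution `X → >–<` (README §1, Lemmas 1–2; `junction_rows.py` unit
tests). Pure linear algebra over a field (duals of vector spaces); no definition (the alternating forms used are Mathlib's `linMulLin φ ψ − linMulLin ψ φ`), no named fact, no sorry.

References (context only; the lemma is folklore — É. Cartan's lemma on 2-vectors): HOME
`certificates/splitrigidity/README.md` §11; I. Zharkov, *Tropical abelian varieties, Weil classes and the Hodge
conjecture*, arXiv:2002.02347 (2020), §2.
-/

-- `Summit.HodgeConjecture.HodgeConjecture.…` is the mandated namespace (single-conjunct summit).
set_option linter.dupNamespace false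

namespace Summit.HodgeConjecture.HodgeConjecture.Theorems.TropicalWeilVanishing.JunctionTear

variable {K : Type*} [Field K] {P : Type*} [AddCommGroup P] [Module K P]

/-- The alternating form `φ ∧ ψ : (u, v) ↦ φ u · ψ v − ψ u · φ v` (as `linMulLin φ ψ − linMulLin ψ φ`,
`BilinForm = P →ₗ P →ₗ K`) evaluates as displayed. [folklore] -/
theorem wedge_apply (φ ψ : Module.Dual K P) (u v : P) :
    (LinearMap.BilinForm.linMulLin φ ψ - LinearMap.BilinForm.linMulLin ψ φ) u v = φ u * ψ v - ψ u * φ v := by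
  simp only [LinearMap.sub_apply, LinearMap.BilinForm.linMulLin_apply]

/-- `φ ∧ ψ` is alternating. [folklore] -/
theorem wedge_self (φ ψ : Module.Dual K P) (v : P) :
    (LinearMap.BilinForm.linMulLin φ ψ - LinearMap.BilinForm.linMulLin ψ φ) v v = 0 := by
  rw [wedge_apply]; ring

/-- A vector killed by every functional that kills `n` and `m` lies in the span of `n` and `m`
(double annihilator in a vector space). [folklore] -/
theorem mem_span_pair_of_forall_dual (n m x : P)
    (h : ∀ θ : Module.Dual K P, θ n = 0 → θ m = 0 → θ x = 0) :
    ∃ a b : K, a • n + b • m = x := by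
  have hx : x ∈ (Submodule.span K ({n, m} : Set P)).dualAnnihilator.dualCoannihilator := by
    rw [Submodule.mem_dualCoannihilator]
    intro θ hθ
    rw [Submodule.mem_dualAnnihilator] at hθ
    exact h θ (hθ n (Submodule.subset_span (by simp))) (hθ m (Submodule.subset_span (by simp)))
  rw [Subspace.dualAnnihilator_dualCoannihilator_eq] at hx
  exact Submodule.mem_span_pair.mp hx

/-- For linearly independent `n, m` there is a functional vanishing on `n` and equal to `1` on `m`.
[folklore] -/
theorem exists_dual_zero_one (n m : P) (hind : ∀ s t : K, s • n + t • m = 0 → s = 0 ∧ t = 0) :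
    ∃ θ : Module.Dual K P, θ n = 0 ∧ θ m = 1 := by
  classical
  -- `m ∉ span {n}`; separate by a functional from the annihilator of `span {n}`
  have hm : m ∉ (Submodule.span K ({n} : Set P)) := by
    intro hmem
    obtain ⟨s, hs⟩ := Submodule.mem_span_singleton.mp hmem
    have := hind s (-1) (by rw [hs, neg_one_smul, add_neg_cancel])
    exact one_ne_zero (neg_eq_zero.mp this.2)
  have hm' : m ∉ (Submodule.span K ({n} : Set P)).dualAnnihilator.dualCoannihilator := by
    rwa [Subspace.dualAnnihilator_dualCoannihilator_eq]
  rw [Submodule.mem_dualCoannihilator] at hm'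
  push Not at hm'
  obtain ⟨θ, hθ, hθm⟩ := hm'
  rw [Submodule.mem_dualAnnihilator] at hθ
  have hθn : θ n = 0 := hθ n (Submodule.subset_span (by simp))
  refine ⟨(θ m)⁻¹ • θ, ?_, ?_⟩
  · simp [hθn]
  · simp [inv_mul_cancel₀ hθm]

/-- **Cartan's two-term lemma (the content of the moment identity (II) at a trivalent wall and at an
X-crossing).** Let `n, m` be linearly independent. Then `B(x, n) + B(y, m) = 0` for every alternating bilinear
form `B` if and only if `x = a•n + b•m` and `y = b•n + c•m` with the SAME `b`. Read at a trivalent wall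
(`x = u₁ − u₃`, `y = u₂ − u₃`, `n = W₁n₁`, `m = W₂n₂`): the three strata keep a common moved copy of the wall
(concurrency, no tear). Read at an X-crossing of two flat sheets (`x = W₁(u_A − u_B)`, `y = W₂(u_C − u_D)`):
`W₁(u_A − u_B) ≡ b·m (mod n)` and `W₂(u_C − u_D) ≡ b·n (mod m)` — the two sheets tear by proportional transversal
offsets, ONE parameter `b` (HOME `certificates/schoenjunction/README.md` §1, Lemmas 1–2). [folklore] -/
theorem cartan_two (n m x y : P) (hind : ∀ s t : K, s • n + t • m = 0 → s = 0 ∧ t = 0) :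
    (∀ B : P →ₗ[K] P →ₗ[K] K, (∀ v, B v v = 0) → B x n + B y m = 0) ↔
      ∃ a b c : K, x = a • n + b • m ∧ y = b • n + c • m := by
  constructor
  · intro hmom
    -- Step 1: `x, y ∈ span {n, m}`: test (II) against `θ ∧ ψ` with `θ n = θ m = 0`.
    have key : ∀ θ : Module.Dual K P, θ n = 0 → θ m = 0 → θ x = 0 ∧ θ y = 0 := by
      intro θ hn hm
      have hv : θ x • n + θ y • m = 0 := by
        rw [← Module.forall_dual_apply_eq_zero_iff K (θ x • n + θ y • m)]
        intro ψ
        have h := hmom _ (wedge_self θ ψ)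
        rw [wedge_apply, wedge_apply, hn, hm] at h
        simp only [map_add, map_smul, smul_eq_mul]
        linear_combination h
      exact hind _ _ hv
    obtain ⟨a, b, hxy⟩ := mem_span_pair_of_forall_dual n m x (fun θ hn hm => (key θ hn hm).1)
    obtain ⟨b', c, hy⟩ := mem_span_pair_of_forall_dual n m y (fun θ hn hm => (key θ hn hm).2)
    -- Step 2: the coefficient matrix is symmetric: test against `θ ∧ ψ` with `θ n = 0, θ m = 1, ψ m = 0, ψ n = 1`.
    obtain ⟨θ, hθn, hθm⟩ := exists_dual_zero_one n m hind
    obtain ⟨ψ, hψm, hψn⟩ := exists_dual_zero_one m n (fun s t hst => by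
      have := hind t s (by rw [add_comm]; exact hst); exact ⟨this.2, this.1⟩)
    have h := hmom _ (wedge_self θ ψ)
    rw [← hxy, ← hy, wedge_apply, wedge_apply] at h
    simp only [map_add, map_smul, smul_eq_mul, hθn, hθm, hψm, hψn] at h
    have hbb : b' = b := by linear_combination -h
    exact ⟨a, b, c, hxy.symm, by rw [← hy, hbb]⟩
  · rintro ⟨a, b, c, rfl, rfl⟩ B hB
    -- alternating ⇒ antisymmetric: `B n m = - B m n`
    have hanti : B m n = -B n m := by
      have h := hB (n + m)
      simp only [map_add, LinearMap.add_apply, hB, zero_add, add_zero] at h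
      linear_combination h
    simp only [map_add, map_smul, LinearMap.add_apply, LinearMap.smul_apply, smul_eq_mul, hB, mul_zero,
      add_zero, zero_add, hanti]
    ring

/-- **Corollary (Lemma 1 of the README: no tear at a trivalent wall).** Three strata with velocities
`u₁ u₂ u₃`, weighted directions `n = W₁n₁`, `m = W₂n₂`, `W₃n₃ = −(n + m)` (balancing), satisfying (II) for every
alternating form, have a COMMON point modulo their own directions: there is `u` with `u₁ − u ∈ K·n`,
`u₂ − u ∈ K·m`, `u₃ − u ∈ K·(n + m)`. [folklore] -/
theorem exists_concurrent_of_moment (n m u₁ u₂ u₃ : P) (hind : ∀ s t : K, s • n + t • m = 0 → s = 0 ∧ t = 0)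
    (hmom : ∀ B : P →ₗ[K] P →ₗ[K] K, (∀ v, B v v = 0) → B (u₁ - u₃) n + B (u₂ - u₃) m = 0) :
    ∃ u : P, (∃ t : K, u₁ - u = t • n) ∧ (∃ t : K, u₂ - u = t • m) ∧ (∃ t : K, u₃ - u = t • (n + m)) := by
  obtain ⟨a, b, c, hx, hy⟩ := (cartan_two n m (u₁ - u₃) (u₂ - u₃) hind).mp hmom
  refine ⟨u₃ + b • (n + m), ⟨a - b, ?_⟩, ⟨c - b, ?_⟩, ⟨-b, ?_⟩⟩
  · have : u₁ - (u₃ + b • (n + m)) = (u₁ - u₃) - b • (n + m) := by abel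
    rw [this, hx, smul_add, sub_smul]; abel
  · have : u₂ - (u₃ + b • (n + m)) = (u₂ - u₃) - b • (n + m) := by abel
    rw [this, hy, smul_add, sub_smul]; abel
  · rw [neg_smul]; abel

/-- **Corollary (Lemma 2 of the README: an X-crossing has exactly one tear parameter).** Two flat sheets with
halves `A, B` (directions `±n`, weight `W₁`) and `C, D` (directions `±m`, weight `W₂`) crossing along a
codimension-one stratum, `n, m` independent: (II) for every alternating form holds iff there is ONE scalar `b`
with `W₁(u_A − u_B) − b•m ∈ K·n` and `W₂(u_C − u_D) − b•n ∈ K·m` (proportional transversal offsets of the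
two sheets — the tropical resolution of the crossing; `b = 0` is 'no tear'). [folklore] -/
theorem tear_iff_moment (n m uA uB uC uD : P) (W₁ W₂ : K)
    (hind : ∀ s t : K, s • n + t • m = 0 → s = 0 ∧ t = 0) :
    (∀ B : P →ₗ[K] P →ₗ[K] K, (∀ v, B v v = 0) →
        W₁ * B uA n + W₁ * B uB (-n) + W₂ * B uC m + W₂ * B uD (-m) = 0) ↔
      ∃ b : K, (∃ a : K, W₁ • (uA - uB) - b • m = a • n) ∧ (∃ c : K, W₂ • (uC - uD) - b • n = c • m) := by
  have hrw : ∀ B : P →ₗ[K] P →ₗ[K] K,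
      W₁ * B uA n + W₁ * B uB (-n) + W₂ * B uC m + W₂ * B uD (-m)
        = B (W₁ • (uA - uB)) n + B (W₂ • (uC - uD)) m := by
    intro B
    simp only [map_smul, map_sub, map_neg, LinearMap.smul_apply, LinearMap.sub_apply, smul_eq_mul]
    ring
  simp_rw [hrw]
  rw [cartan_two n m _ _ hind]
  constructor
  · rintro ⟨a, b, c, hx, hy⟩
    exact ⟨b, ⟨a, by rw [hx]; abel⟩, ⟨c, by rw [hy]; abel⟩⟩
  · rintro ⟨b, ⟨a, ha⟩, ⟨c, hc⟩⟩
    refine ⟨a, b, c, ?_, ?_⟩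
    · rw [← ha]; abel
    · rw [add_comm, ← hc]; abel


/-! ### Appended (same generation): the naked-region rule — a flat sheet alone cannot be torn -/

/-- **A vector that every alternating form kills against a non-zero `n` is a multiple of `n`.** If `B(x, n) = 0`
for every alternating bilinear form `B` and `n ≠ 0`, then `x ∈ K·n` (test against `θ ∧ ψ` with `θ n = 0`,
`ψ n = 1`; double annihilator). [folklore] -/
theorem exists_smul_of_forall_moment (n x : P) (hn : n ≠ 0)
    (hmom : ∀ B : P →ₗ[K] P →ₗ[K] K, (∀ v, B v v = 0) → B x n = 0) : ∃ t : K, x = t • n := by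
  -- a functional equal to 1 on n
  obtain ⟨ψ, hψ⟩ := Module.Projective.exists_dual_ne_zero K hn
  -- every functional killing n kills x
  have key : ∀ θ : Module.Dual K P, θ n = 0 → θ x = 0 := by
    intro θ hθ
    have h := hmom _ (wedge_self θ ((ψ n)⁻¹ • ψ))
    rw [wedge_apply, hθ] at h
    simp only [LinearMap.smul_apply, smul_eq_mul, inv_mul_cancel₀ hψ, mul_one, mul_zero, sub_zero] at h
    exact h
  have hx : x ∈ (Submodule.span K ({n} : Set P)).dualAnnihilator.dualCoannihilator := by
    rw [Submodule.mem_dualCoannihilator]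
    intro θ hθ
    rw [Submodule.mem_dualAnnihilator] at hθ
    exact key θ (hθ n (Submodule.subset_span (by simp)))
  rw [Subspace.dualAnnihilator_dualCoannihilator_eq, Submodule.mem_span_singleton] at hx
  obtain ⟨t, ht⟩ := hx
  exact ⟨t, ht.symm⟩

/-- **The naked-region rule (Lemma 3 of HOME `certificates/schoenjunction/README.md` §1): a flat sheet alone is
pinned.** Where the only strata through a codimension-one locus are the two halves `u₊, u₋` of ONE flat sheet
(directions `±n`, weight `W ≠ 0`), condition (II) — `W·B(u₊, n) + W·B(u₋, −n) = 0` for every alternating `B` —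
forces `u₊ − u₋ ∈ K·n`: the two halves move as one sheet (no offset). Hence a foreign sheet crossing a wall
contributes nothing to (II) at that wall as soon as some open part of its crossing section is free of other
strata. [folklore] -/
theorem flat_pinned_of_moment (n uP uM : P) (W : K) (hn : n ≠ 0) (hW : W ≠ 0)
    (hmom : ∀ B : P →ₗ[K] P →ₗ[K] K, (∀ v, B v v = 0) → W * B uP n + W * B uM (-n) = 0) :
    ∃ t : K, uP - uM = t • n := by
  refine exists_smul_of_forall_moment n (uP - uM) hn (fun B hB => ?_)
  have h := hmom B hB
  rw [map_neg, ← mul_add, mul_eq_zero] at h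
  rcases h with h | h
  · exact absurd h hW
  · rw [map_sub, LinearMap.sub_apply]
    linear_combination h


/-! ### Appended (same generation): Cartan's lemma for any number of independent directions — the
count of tear parameters at a codimension-one locus of any valence -/

/-- **Cartan's lemma, k terms.** Let `(n_i)` be a finite family admitting a dual family of functionals
(`θ_i(n_j) = δ_ij` — in a vector space this is linear independence) and `(x_i)` arbitrary. Then
`Σ_i B(x_i, n_i) = 0` for EVERY alternating bilinear form `B` iff `x_i = Σ_j a_ij • n_j` with a SYMMETRIC
matrix `a`. Read at a codimension-one locus where `k` sheets with independent transversal directions meet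
(after absorbing weights and reference strata into the `x_i`, as in `cartan_two`): condition (II) of the junction
test leaves exactly the symmetric `k × k` matrices of offsets — `k(k+1)/2` parameters, of which the diagonal
ones are invisible modulo the sheets' own planes: `k(k−1)/2` TEAR PARAMETERS (k = 2: one, `tear_iff_moment`;
k = 3, e.g. a trivalent fan inside a foreign sheet or three sheets through one plane: three). [folklore] -/
theorem cartan_family {ι : Type*} [Fintype ι] [DecidableEq ι] (nv x : ι → P)
    (hdual : ∀ i, ∃ θ : Module.Dual K P, ∀ j, θ (nv j) = if j = i then 1 else 0) :
    (∀ B : P →ₗ[K] P →ₗ[K] K, (∀ v, B v v = 0) → ∑ i, B (x i) (nv i) = 0) ↔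
      ∃ a : ι → ι → K, (∀ i j, a i j = a j i) ∧ ∀ i, x i = ∑ j, a i j • nv j := by
  classical
  choose θ hθ using hdual
  constructor
  · intro hmom
    -- Step 1: every functional killing all `nv j` kills every `x i`
    have key : ∀ φ : Module.Dual K P, (∀ j, φ (nv j) = 0) → ∀ i, φ (x i) = 0 := by
      intro φ hφ
      have hv : ∑ i, φ (x i) • nv i = 0 := by
        rw [← Module.forall_dual_apply_eq_zero_iff K (∑ i, φ (x i) • nv i)]
        intro ψ
        have h := hmom _ (wedge_self φ ψ)
        simp only [wedge_apply, hφ, mul_zero, sub_zero] at h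
        simp only [map_sum, map_smul, smul_eq_mul]
        exact h
      intro i
      have h := congrArg (θ i) hv
      simp only [map_sum, map_smul, smul_eq_mul, hθ, mul_ite, mul_one, mul_zero, Finset.sum_ite_eq',
        Finset.mem_univ, if_true, map_zero] at h
      exact h
    -- hence `x i ∈ span (range nv)`
    have hspan : ∀ i, ∃ c : ι → K, ∑ j, c j • nv j = x i := by
      intro i
      have hx : x i ∈ (Submodule.span K (Set.range nv)).dualAnnihilator.dualCoannihilator := by
        rw [Submodule.mem_dualCoannihilator]
        intro φ hφ
        rw [Submodule.mem_dualAnnihilator] at hφ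
        exact key φ (fun j => hφ (nv j) (Submodule.subset_span (Set.mem_range_self j))) i
      rw [Subspace.dualAnnihilator_dualCoannihilator_eq, Submodule.mem_span_range_iff_exists_fun] at hx
      exact hx
    choose c hc using hspan
    refine ⟨c, ?_, fun i => (hc i).symm⟩
    -- Step 2: symmetry, testing against `θ p ∧ θ q`
    intro p q
    have h := hmom _ (wedge_self (θ q) (θ p))
    have eval : ∀ r i, θ r (x i) = c i r := by
      intro r i
      rw [← hc i]
      simp only [map_sum, map_smul, smul_eq_mul, hθ, mul_ite, mul_one, mul_zero, Finset.sum_ite_eq',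
        Finset.mem_univ, if_true]
    simp only [wedge_apply, eval, hθ, mul_ite, mul_one, mul_zero,
      Finset.sum_sub_distrib, Finset.sum_ite_eq', Finset.mem_univ, if_true] at h
    linear_combination h
  · rintro ⟨a, hsym, hx⟩ B hB
    have hanti : ∀ u v : P, B u v + B v u = 0 := by
      intro u v
      have h := hB (u + v)
      simp only [map_add, LinearMap.add_apply, hB, zero_add, add_zero] at h
      linear_combination h
    have expand : ∑ i, B (x i) (nv i) = ∑ p : ι × ι, a p.1 p.2 * B (nv p.2) (nv p.1) := by
      simp_rw [hx, map_sum, map_smul, LinearMap.sum_apply, LinearMap.smul_apply, smul_eq_mul]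
      rw [← Finset.sum_product']
      rfl
    rw [expand]
    refine Finset.sum_involution (fun p _ => (p.2, p.1)) ?_ ?_ (fun p _ => Finset.mem_univ _) (fun p _ => rfl)
    · rintro ⟨i, j⟩ -
      simp only
      rw [hsym j i, ← mul_add, hanti, mul_zero]
    · rintro ⟨i, j⟩ - hne
      simp only [ne_eq, Prod.mk.injEq, not_and]
      intro hji hij
      apply hne
      subst hji
      simp only [hB, mul_zero]


/-- **A linearly independent finite family in a vector space has a dual family of functionals**
(`θ_i(n_j) = δ_ij`) — the hypothesis of `cartan_family`. [folklore] -/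
theorem exists_dual_family {ι : Type*} [Fintype ι] [DecidableEq ι] (nv : ι → P)
    (hind : LinearIndependent K nv) (i : ι) :
    ∃ θ : Module.Dual K P, ∀ j, θ (nv j) = if j = i then 1 else 0 := by
  classical
  -- `nv i ∉ span (nv '' {j | j ≠ i})`
  have hi : nv i ∉ Submodule.span K (nv '' ({i}ᶜ : Set ι)) :=
    hind.notMem_span_image (by simp)
  have hi' : nv i ∉ (Submodule.span K (nv '' ({i}ᶜ : Set ι))).dualAnnihilator.dualCoannihilator := by
    rwa [Subspace.dualAnnihilator_dualCoannihilator_eq]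
  rw [Submodule.mem_dualCoannihilator] at hi'
  push Not at hi'
  obtain ⟨θ, hθ, hθi⟩ := hi'
  rw [Submodule.mem_dualAnnihilator] at hθ
  refine ⟨(θ (nv i))⁻¹ • θ, fun j => ?_⟩
  by_cases hji : j = i
  · subst hji; simp [inv_mul_cancel₀ hθi]
  · have : θ (nv j) = 0 := hθ _ (Submodule.subset_span ⟨j, by simpa using hji, rfl⟩)
    simp [this, hji]

end Summit.HodgeConjecture.HodgeConjecture.Theorems.TropicalWeilVanishing.JunctionTear
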